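import Mathlib
import HarnessLib

/-!
# Toric pseudo-Eisenstein series: definition, translation law, local finiteness, continuity

Topic `NumberTheory/Automorphic`; namespace `Literature.NumberTheory.Automorphic.PseudoEisenstein`.

A *pseudo-Eisenstein series* (Godement's "incomplete theta series" [Godement1966]; the name is
Moeglin–Waldspurger's [MoeglinWaldspurger1995, II.1.10]) attached to a subgroup `H` of `G` and a
function `φ` on `G` that is compactly supported modulo `H` is the sum `Ψ_φ(g) = Σ_{γ ∈ Γ_H\Γ} φ(γ g)`
over the cosets of `Γ_H = Γ ∩ H` in the lattice `Γ`; it is *locally finite* (for `g` in a compact set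
only finitely many summands are non-zero), hence a continuous compactly supported function on `Γ\G`,
and it fits into the unwinding adjunction `∫_{Γ_H H\G} φ · c_H f = ∫_{Γ\G} Ψ_φ · f` with the `H`-period
("constant term") `c_H f` [Garrett2018, §1.8, Claim 1.8.1 and Cor. 1.8.2] (there for `H = N` unipotent;
the argument uses only "`Γ` discrete, `φ` compactly supported modulo `H`, `Γ_H\H` compact").

This file records the **toric** instance (`H = T` a torus, twisted by a character `χ` of `T`), in an
abstract harmonic-analysis model that needs no adelic vocabulary:

* `G` — a group with a topology (later: locally compact Hausdorff, with a left-invariant measure `μ`);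
  `Γ ≤ G` a subgroup meeting every compact set in a finite set (`DiscreteMeets Γ`);
* `T` — a topological group with a measure `ν`, mapped into `G` by a continuous homomorphism
  `jT : T →* G`; `χ : T → ℂ` continuous;
* the compact quotient `Γ_T\T` is realised by a continuous compactly supported weight `β : T → ℝ`
  (a `Γ_T`-partition of unity `Σ_δ β(δ t) = 1`, which exists exactly when the quotient is compact —
  see `Literature.MeasureTheory.Group.CocompactPartitionOfUnity`): `∫_{Γ_T\T} F = ∫_T β F dν` for
  left-`Γ_T`-invariant `F`. Only "continuous" and "compactly supported" are used in this file; the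
  normalisation is what identifies `Σ_{γ ∈ Γ} Ξ_β(γ y)` with the coset sum `Σ_{γ ∈ Γ_T\Γ} Ξ(γ y)` of the
  full torus integrals (`ToricPseudoEisensteinFidelity`).

## Contents

* `Xi ν jT χ f y = ∫_T χ(t) f(jT(t)⁻¹ y) dν` — the full toric transform; `Xi_equivariant` :
  `Ξ(jT(s) y) = χ(s) Ξ(y)` for `ν` left-invariant and `χ` multiplicative;
* `Xiβ` — the `β`-truncated transform `Ξ_β(y) = ∫_T β(t) χ(t) f(jT(t)⁻¹ y) dν`;
  `Eis ν jT β χ Γ f y = Σ'_{γ ∈ Γ} Ξ_β(γ y)` — the toric pseudo-Eisenstein series;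
  `toricPeriod` — the (truncated) toric period `∫_T β χ · K(jT(·) h) dν`; `rTrans` — right translates;
* `Xiβ_rTrans`, `Eis_rTrans` : `E_{f(· h₀)}(y) = E_f(y h₀)` (the translation law `R(h₀) E_f = E_{R(h₀) f}`);
  `Eis_leftInvariant` : `E_f` is left-`Γ`-invariant, i.e. a function on `Γ\G`;
* `Xiβ_eq_zero_of_notMem`, `hasCompactSupport_Xiβ` : `Ξ_β` is supported in the compact set
  `jT(tsupport β) · tsupport f`; `continuous_Xiβ`;
* `Eis_support_finite` : local finiteness — for every `y` only finitely many `γ ∈ Γ` contribute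
  [Garrett2018, Claim 1.8.1]; `continuous_Eis` : on a locally compact `G` the series is locally a finite
  sum of translates of `Ξ_β`, hence continuous.

The unwinding adjunction is `ToricPseudoEisensteinUnfolding`; the comparison with the coset sum of full
torus integrals is `ToricPseudoEisensteinFidelity`.

Provenance: HodgeCM PerL cell `pub-hodgecm`, package file `HodgeCM/PerL34/PseudoEisenstein.lean`
(seat pv15, gate run 20; there the consumer is the isolation step for toric periods of theta lifts),
ported to the tree under the LEAN-IN-TREE rule by seat pv15-g7 (names `HodgeCM.PerL34.N23a.X` ↦
`Literature.NumberTheory.Automorphic.PseudoEisenstein.X`, statements verbatim).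

## References

* R. Godement, *The spectral decomposition of cusp-forms*, Proc. Sympos. Pure Math. IX (1966),
  225–234, §3 (incomplete theta series) [Godement1966].
* C. Moeglin, J.-L. Waldspurger, *Spectral Decomposition and Eisenstein Series* (1995), II.1.10
  (pseudo-Eisenstein series; Proposition: convergence uniform on compact sets), II.1.11–II.1.12
  [MoeglinWaldspurger1995].
* P. Garrett, *Modern Analysis of Automorphic Forms by Example*, vol. 1 (2018), §1.8 (pseudo-Eisenstein
  series: Claim 1.8.1 local finiteness, Cor. 1.8.2 adjunction) [Garrett2018].
-/

noncomputable section

open _root_.MeasureTheory Set Filter Function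
open scoped Pointwise ENNReal

namespace Literature.NumberTheory.Automorphic

namespace PseudoEisenstein

/-! ## Definitions (explicit binders: each object carries exactly the structure it needs) -/

/-- The weight `β(t) χ(t)` realising `χ(t) dt` on the compact quotient `Γ_T\T` through the
partition-of-unity weight `β`. [folklore] -/
def wt {T : Type*} (β : T → ℝ) (χ : T → ℂ) (t : T) : ℂ := (β t : ℂ) * χ t

/-- The full toric transform `Ξ^χ_f(y) := ∫_T χ(t) f(jT(t)⁻¹ y) dν(t)` — a `(T, χ)`-equivariant
function on `G`, compactly supported modulo `jT(T)` when `f ∈ C_c(G)` and `jT` is proper.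
[cite: Garrett2018, §1.8] -/
def Xi {G T : Type*} [Group G] [Group T] [MeasurableSpace T]
    (ν : Measure T) (jT : T →* G) (χ : T → ℂ) (f : G → ℂ) (y : G) : ℂ :=
  ∫ t, χ t * f ((jT t)⁻¹ * y) ∂ν

/-- The `β`-truncated toric transform `Ξ_β(y) := ∫_T β(t) χ(t) f(jT(t)⁻¹ y) dν(t)`; summing it over
the FULL group `Γ` gives the sum of the full transforms `Ξ^χ_f` over the cosets `Γ_T\Γ` (when
`Σ_δ β(δ t) = 1`, see `ToricPseudoEisensteinFidelity`). [cite: Garrett2018, §1.8] -/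
def Xiβ {G T : Type*} [Group G] [Group T] [MeasurableSpace T]
    (ν : Measure T) (jT : T →* G) (β : T → ℝ) (χ : T → ℂ) (f : G → ℂ) (y : G) : ℂ :=
  ∫ t, wt β χ t * f ((jT t)⁻¹ * y) ∂ν

/-- The toric pseudo-Eisenstein series `E^χ_f(y) = Σ_{γ ∈ Γ} Ξ_β(γ y)`, a left-`Γ`-invariant
function on `G`, i.e. a function on `Γ\G` (Godement's incomplete theta series, for a torus in place
of a unipotent radical). [cite: MoeglinWaldspurger1995, II.1.10] -/
def Eis {G T : Type*} [Group G] [Group T] [MeasurableSpace T]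
    (ν : Measure T) (jT : T →* G) (β : T → ℝ) (χ : T → ℂ) (Γ : Subgroup G) (f : G → ℂ)
    (y : G) : ℂ :=
  ∑' γ : Γ, Xiβ ν jT β χ f ((γ : G) * y)

/-- The toric period of a function `K` on `G` along the `T`-orbit through `h`:
`P(K)(h) := ∫_{Γ_T\T} K(t h) χ(t) dt`, realised as `∫_T β(t) χ(t) K(jT(t) h) dν(t)`.
[cite: Garrett2018, §1.8] -/
def toricPeriod {G T : Type*} [Group G] [Group T] [MeasurableSpace T]
    (ν : Measure T) (jT : T →* G) (β : T → ℝ) (χ : T → ℂ) (K : G → ℂ) (h : G) : ℂ :=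
  ∫ t, wt β χ t * K (jT t * h) ∂ν

/-- Right translate `f^{h₀}(x) := f(x h₀)` (the right regular action on functions). [folklore] -/
def rTrans {G : Type*} [Group G] (f : G → ℂ) (h₀ : G) : G → ℂ := fun x => f (x * h₀)

/-- "`Γ` is discrete in `G`" in the form used for local finiteness: `Γ` meets every compact set of
`G` in a finite set (equivalent, for a subgroup of a Hausdorff topological group, to being discrete
and closed). [folklore] -/
def DiscreteMeets {G : Type*} [Group G] [TopologicalSpace G] (Γ : Subgroup G) : Prop :=
  ∀ C : Set G, IsCompact C → {γ : Γ | (γ : G) ∈ C}.Finite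

/-! ## Equivariance, translation law, invariance, local finiteness -/

section Basic

variable {G : Type*} [Group G] {T : Type*} [Group T] [MeasurableSpace T]

/-- Equivariance of the full toric transform: `Ξ^χ_f(jT(s) y) = χ(s) Ξ^χ_f(y)`, for `ν`
left-invariant and `χ` multiplicative. [cite: Garrett2018, §1.8] -/
theorem Xi_equivariant [MeasurableMul T] (ν : Measure T) [ν.IsMulLeftInvariant] (jT : T →* G)
    (χ : T → ℂ)
    (hχ : ∀ s t, χ (s * t) = χ s * χ t) (f : G → ℂ) (s : T) (y : G) :
    Xi ν jT χ f (jT s * y) = χ s * Xi ν jT χ f y := by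
  unfold Xi
  have h1 : ∀ t, χ t * f ((jT t)⁻¹ * (jT s * y))
      = χ s * (χ (s⁻¹ * t) * f ((jT (s⁻¹ * t))⁻¹ * y)) := by
    intro t
    have e1 : (jT (s⁻¹ * t))⁻¹ * y = (jT t)⁻¹ * (jT s * y) := by
      simp only [map_mul, map_inv, mul_inv_rev, inv_inv, mul_assoc]
    have e2 : χ s * χ (s⁻¹ * t) = χ t := by rw [← hχ, mul_inv_cancel_left]
    rw [e1, ← e2]
    ring
  simp_rw [h1]
  rw [integral_const_mul]
  congr 1
  exact integral_mul_left_eq_self (fun t => χ t * f ((jT t)⁻¹ * y)) s⁻¹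

/-- `Ξ_β` of the right translate: `Ξ_β(f^{h₀})(y) = Ξ_β(f)(y h₀)`. [folklore] -/
theorem Xiβ_rTrans (ν : Measure T) (jT : T →* G) (β : T → ℝ) (χ : T → ℂ) (f : G → ℂ)
    (h₀ y : G) : Xiβ ν jT β χ (rTrans f h₀) y = Xiβ ν jT β χ f (y * h₀) := by
  simp only [Xiβ, rTrans, mul_assoc]

/-- **Translation law**: `E^χ_{f^{h₀}}(y) = E^χ_f(y h₀)`, i.e. `R(h₀) E^χ_f = E^χ_{f^{h₀}}` for the
right regular representation `(R(h₀)u)(y) = u(y h₀)` — the family of pseudo-Eisenstein series is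
stable under right translation. [cite: Garrett2018, §1.8] -/
theorem Eis_rTrans (ν : Measure T) (jT : T →* G) (β : T → ℝ) (χ : T → ℂ) (Γ : Subgroup G)
    (f : G → ℂ) (h₀ y : G) :
    Eis ν jT β χ Γ (rTrans f h₀) y = Eis ν jT β χ Γ f (y * h₀) := by
  simp only [Eis, Xiβ_rTrans, mul_assoc]

/-- `E^χ_f` is left-`Γ`-invariant: it is a function on `Γ\G`. [cite: Garrett2018, §1.8] -/
theorem Eis_leftInvariant (ν : Measure T) (jT : T →* G) (β : T → ℝ) (χ : T → ℂ) (Γ : Subgroup G)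
    (f : G → ℂ) (γ₀ : Γ) (y : G) :
    Eis ν jT β χ Γ f ((γ₀ : G) * y) = Eis ν jT β χ Γ f y := by
  unfold Eis
  have := (Equiv.mulRight γ₀).tsum_eq (fun γ : Γ => Xiβ ν jT β χ f ((γ : G) * y))
  simpa only [Equiv.coe_mulRight, Subgroup.coe_mul, mul_assoc] using this

/-- Vanishing of `Ξ_β` off the compact set `jT(tsupport β) · tsupport f`. [folklore] -/
theorem Xiβ_eq_zero_of_notMem [TopologicalSpace G] [TopologicalSpace T] (ν : Measure T)
    (jT : T →* G) (β : T → ℝ) (χ : T → ℂ) (f : G → ℂ)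
    {z : G} (hz : z ∉ ((jT : T → G) '' tsupport β) * tsupport f) :
    Xiβ ν jT β χ f z = 0 := by
  unfold Xiβ
  have hzero : ∀ t, wt β χ t * f ((jT t)⁻¹ * z) = 0 := by
    intro t
    by_cases ht : t ∈ tsupport β
    · have hf0 : f ((jT t)⁻¹ * z) = 0 := by
        apply image_eq_zero_of_notMem_tsupport
        intro hmem
        apply hz
        refine Set.mem_mul.mpr ⟨jT t, Set.mem_image_of_mem _ ht, (jT t)⁻¹ * z, hmem, ?_⟩
        simp
      rw [hf0, mul_zero]
    · have hb : β t = 0 := image_eq_zero_of_notMem_tsupport ht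
      simp [wt, hb]
  simp_rw [hzero]
  simp

/-- **Local finiteness**: for each `y` only finitely many `γ ∈ Γ` contribute to `E^χ_f(y)`, because
`Γ` meets compact sets in finite sets and `Ξ_β` is supported in the compact set
`jT(tsupport β) · tsupport f`. [cite: Garrett2018, Claim 1.8.1] -/
theorem Eis_support_finite [TopologicalSpace G] [IsTopologicalGroup G] [T2Space G]
    [TopologicalSpace T] (ν : Measure T) (jT : T →* G) (hjT : Continuous jT)
    (β : T → ℝ) (hβs : HasCompactSupport β) (χ : T → ℂ) (Γ : Subgroup G) (hΓ : DiscreteMeets Γ)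
    (f : G → ℂ) (hfs : HasCompactSupport f) (y : G) :
    (Function.support fun γ : Γ => Xiβ ν jT β χ f ((γ : G) * y)).Finite := by
  set C : Set G := ((jT : T → G) '' tsupport β) * tsupport f with hC
  have hCc : IsCompact C := (hβs.isCompact.image hjT).mul hfs.isCompact
  have hC' : IsCompact ((fun x : G => x * y⁻¹) '' C) := hCc.image (continuous_id.mul continuous_const)
  refine (hΓ _ hC').subset ?_
  intro γ hγ
  have hmem : (γ : G) * y ∈ C := by
    by_contra h
    exact hγ (Xiβ_eq_zero_of_notMem ν jT β χ f h)
  exact ⟨(γ : G) * y, hmem, by simp⟩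

end Basic

/-! ## Regularity of `Ξ_β` -/

section Regularity

variable {G : Type*} [Group G] [TopologicalSpace G] [IsTopologicalGroup G]
  {T : Type*} [Group T] [TopologicalSpace T] [MeasurableSpace T]

omit [Group T] [MeasurableSpace T] in
/-- The weight `β χ` is continuous when `β` and `χ` are. [folklore] -/
theorem continuous_wt {β : T → ℝ} (hβ : Continuous β) {χ : T → ℂ} (hχ : Continuous χ) :
    Continuous (wt β χ) :=
  (Complex.continuous_ofReal.comp hβ).mul hχ

omit [Group T] [MeasurableSpace T] in
/-- The weight `β χ` vanishes off `tsupport β`. [folklore] -/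
theorem wt_eq_zero_of_notMem (β : T → ℝ) (χ : T → ℂ) {t : T} (ht : t ∉ tsupport β) :
    wt β χ t = 0 := by
  have hb : β t = 0 := image_eq_zero_of_notMem_tsupport ht
  simp [wt, hb]

/-- `Ξ_β` is continuous (a parametric integral of a continuous, uniformly compactly supported
kernel). [folklore] -/
theorem continuous_Xiβ [OpensMeasurableSpace T] (ν : Measure T) [IsFiniteMeasureOnCompacts ν]
    (jT : T →* G) (hjT : Continuous jT)
    (β : T → ℝ) (hβ : Continuous β) (hβs : HasCompactSupport β) (χ : T → ℂ) (hχ : Continuous χ)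
    (f : G → ℂ) (hf : Continuous f) : Continuous (Xiβ ν jT β χ f) := by
  have hk : IsCompact (tsupport β) := hβs
  have hF : ContinuousOn
      (Function.uncurry fun (y : G) (t : T) => wt β χ t * f ((jT t)⁻¹ * y)) (univ ×ˢ univ) := by
    apply Continuous.continuousOn
    change Continuous fun p : G × T => wt β χ p.2 * f ((jT p.2)⁻¹ * p.1)
    exact ((continuous_wt hβ hχ).comp continuous_snd).mul
      (hf.comp (((hjT.comp continuous_snd).inv).mul continuous_fst))
  have hzero : ∀ (p : G) (t : T), p ∈ (univ : Set G) → t ∉ tsupport β →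
      (fun (y : G) (t : T) => wt β χ t * f ((jT t)⁻¹ * y)) p t = 0 := by
    intro p t _ ht
    simp only [wt_eq_zero_of_notMem β χ ht, zero_mul]
  have h := continuousOn_integral_of_compact_support (μ := ν) hk hF hzero
  exact continuousOn_univ.mp h

/-- `Ξ_β` has compact support, contained in `jT(tsupport β) · tsupport f`. [folklore] -/
theorem hasCompactSupport_Xiβ [T2Space G] (ν : Measure T) (jT : T →* G) (hjT : Continuous jT)
    (β : T → ℝ) (hβs : HasCompactSupport β) (χ : T → ℂ) (f : G → ℂ) (hfs : HasCompactSupport f) :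
    HasCompactSupport (Xiβ ν jT β χ f) := by
  apply HasCompactSupport.intro ((hβs.isCompact.image hjT).mul hfs.isCompact)
  intro z hz
  exact Xiβ_eq_zero_of_notMem ν jT β χ f hz

/-- **`E^χ_f` is continuous** (the locally finite sum defines a continuous function): on a compact
neighbourhood `C` of any point only the finitely many `γ ∈ Γ` with
`γ ∈ (jT(tsupport β) · tsupport f) · C⁻¹` contribute, so `E^χ_f` is locally a finite sum of translates
of the continuous `Ξ_β`. Needs `G` locally compact. [cite: Garrett2018, Claim 1.8.1] -/
theorem continuous_Eis [T2Space G] [LocallyCompactSpace G] [OpensMeasurableSpace T]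
    (ν : Measure T) [IsFiniteMeasureOnCompacts ν] (jT : T →* G) (hjT : Continuous jT)
    (β : T → ℝ) (hβ : Continuous β) (hβs : HasCompactSupport β) (χ : T → ℂ) (hχ : Continuous χ)
    (Γ : Subgroup G) (hΓ : DiscreteMeets Γ)
    (f : G → ℂ) (hf : Continuous f) (hfs : HasCompactSupport f) :
    Continuous (Eis ν jT β χ Γ f) := by
  rw [continuous_iff_continuousAt]
  intro y₀
  obtain ⟨C, hC, hCy⟩ := exists_compact_mem_nhds y₀
  set S : Set G := ((jT : T → G) '' tsupport β) * tsupport f with hSdef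
  have hS : IsCompact S := (hβs.isCompact.image hjT).mul hfs.isCompact
  have hfin : {γ : Γ | (γ : G) ∈ S * C⁻¹}.Finite := hΓ _ (hS.mul hC.inv)
  have heq : ∀ y ∈ C,
      Eis ν jT β χ Γ f y = ∑ γ ∈ hfin.toFinset, Xiβ ν jT β χ f ((γ : G) * y) := by
    intro y hy
    unfold Eis
    apply tsum_eq_sum
    intro γ hγ
    apply Xiβ_eq_zero_of_notMem
    intro hmem
    apply hγ
    rw [Set.Finite.mem_toFinset]
    show (γ : G) ∈ S * C⁻¹
    exact Set.mem_mul.2 ⟨(γ : G) * y, hmem, y⁻¹, Set.inv_mem_inv.2 hy, mul_inv_cancel_right _ _⟩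
  have hcont : ContinuousOn
      (fun y => ∑ γ ∈ hfin.toFinset, Xiβ ν jT β χ f ((γ : G) * y)) C := by
    apply Continuous.continuousOn
    apply continuous_finsetSum
    intro γ _
    exact (continuous_Xiβ ν jT hjT β hβ hβs χ hχ f hf).comp (continuous_const.mul continuous_id)
  exact (hcont.congr fun y hy => heq y hy).continuousAt hCy

end Regularity

end PseudoEisenstein

end Literature.NumberTheory.Automorphic

end
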